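import Literature.AlgebraicGeometry.Frobenioids.PreFrobenioidData
import Literature.AlgebraicGeometry.Frobenioids.DilatingMonoidExampleProofs
import Literature.AlgebraicGeometry.Frobenioids.PerfectionStandardTypes
import HarnessLib

/-!
# [FrdI] Definition 1.1 (i), `PreFrobenioidData.IsNonDilating`: the universal closure of the predicate is
# FALSE (kernel witness) — it is a per-instance hypothesis; instance forms

Mochizuki, *The geometry of Frobenioids I: the general theory*, Kyushu J. Math. **62** (2008) 293–400,
Definition 1.1 (i), kurims p. 19 l. 18 [cite: MochizukiFrdI2008, Def. 1.1 (i) p.19]: "we shall say that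
`α` is non-dilating if the endomorphism `α^char` of `M^char` induced by `α` is the identity endomorphism
whenever [`α^char(a) ≼ a` for all primary `a`]"; Example 3.7 p. 70: "`Φ` clearly fails to be non-dilating".

PROOF-ONLY file (abc-iut cell, block F fact-proving wave, seat abc-iut-f-002; FACT-LIST row F-1227,
`Literature.AlgebraicGeometry.Frobenioids.PreFrobenioidData.IsNonDilating`, PreFrobenioidData.lean). The row
is a DEFINITION — a parametrised predicate on an endomorphism `α : M →* M` — so its universal closure
"every endomorphism of every commutative monoid is non-dilating" is not a fact: this file records, kernel
checked, that it is FALSE at every universe level (`PreFrobenioidData.not_forall_isNonDilating`; explicit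
instance `PreFrobenioidData.not_isNonDilating_powMonoidHom_two`: the endomorphism `a ↦ a²` of the
multiplicative monoid `ℕ`, i.e. "multiplication by `2`" on the divisor monoid — the shape of the paper's own
Example 3.7; and, through the bridge `PreFrobenioidData.isNonDilating_iff_isNonDilating`, the paper's
Example 3.7 itself, `PreFrobenioidData.not_isNonDilatingOn_ex37`), together with the instance forms in
which the predicate IS a theorem: every endomorphism inducing the identity on `M^char`
(`PreFrobenioidData.isNonDilating_of_associatesMap_eq`; the identity itself is already
`Literature.AnabelianGeometry.EtaleTheta.Example39NV.isNonDilating_id`, Sec3Example39DataNonVacuity.lean).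
Consumers bind `IsNonDilating` / `IsNonDilatingOn Φ` only at NAMED instances (the model divisor monoids:
`geomDivisorFunctor_isNonDilatingOn`, `arithDivisorFunctor_isNonDilatingOn`, `isNonDilatingOn_natΦ`, …).
No new definition; nothing of [FrdI] is contradicted (Def. 1.1 (i) is a definition, Ex. 3.7 is the
paper's own non-example); nothing here bears on [IUTchIII] Cor. 3.12.
-/

namespace Literature.AlgebraicGeometry.Frobenioids

namespace PreFrobenioidData

universe w

variable {M : Type w} [CommMonoid M]

/-! ### Instance forms: endomorphisms that are non-dilating -/

/-- An endomorphism inducing the identity of `M^char` is non-dilating (the conclusion of Def. 1.1 (i)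
holds outright). [cite: MochizukiFrdI2008, Def. 1.1 (i) p.19] -/
theorem isNonDilating_of_associatesMap_eq (α : M →* M) (h : ∀ a : Associates M, associatesMap α a = a) :
    IsNonDilating α :=
  fun _ => h

/-- A non-dilating endomorphism whose induced map satisfies the hypothesis of Def. 1.1 (i) induces the
identity on `M^char` (the definition, unfolded). [cite: MochizukiFrdI2008, Def. 1.1 (i) p.19] -/
theorem IsNonDilating.associatesMap_eq {α : M →* M} (hα : IsNonDilating α)
    (h : ∀ a : Associates M, IsPrimary a → Precsim (associatesMap α a) a) (a : Associates M) :
    associatesMap α a = a :=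
  hα h a

/-! ### The universal closure is false: "multiplication by `2`" on a divisor monoid -/

/-- **Kernel witness against the universal closure of Def. 1.1 (i)**: the endomorphism `a ↦ a ^ 2` of the
multiplicative monoid `ℕ` (additively: `n ↦ 2n` on the exponents — the pull-back of the paper's Example 3.7)
satisfies the hypothesis of Def. 1.1 (i) (`α^char(a) = a² ≼ a`, exponent `2`) but `α^char ≠ id`
(`[4] ≠ [2]`: the units of `ℕ` are trivial), so it is NOT non-dilating. [cite: MochizukiFrdI2008, Ex. 3.7 p.70] -/
theorem not_isNonDilating_powMonoidHom_two : ¬ IsNonDilating (powMonoidHom 2 : ℕ →* ℕ) := by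
  intro h
  have hyp : ∀ a : Associates ℕ, IsPrimary a → Precsim (associatesMap (powMonoidHom 2 : ℕ →* ℕ) a) a := by
    intro a _
    obtain ⟨x, rfl⟩ := Associates.mk_surjective a
    exact ⟨2, two_pos, by simpa only [associatesMap_mk, powMonoidHom_apply, Associates.mk_pow] using dvd_refl (Associates.mk x ^ 2)⟩
  have key := h hyp (Associates.mk 2)
  rw [associatesMap_mk, powMonoidHom_apply, Associates.mk_eq_mk_iff_associated, associated_iff_eq] at key
  norm_num at key

/-- **The universal closure of FACT-LIST row F-1227 is FALSE, at every universe level `x`**: not every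
endomorphism of every commutative monoid is non-dilating — Def. 1.1 (i) is a condition, witnessed to
fail by `a ↦ a²` on `ULift ℕ` (read back in `ℕ` along `MulEquiv.ulift`; at level `0` this is
`not_isNonDilating_powMonoidHom_two`). The predicate is admissible only as a hypothesis at NAMED
instances. [cite: MochizukiFrdI2008, Def. 1.1 (i) p.19] -/
theorem not_forall_isNonDilating.{x} :
    ¬ ∀ (N : Type x) [CommMonoid N] (α : N →* N), IsNonDilating α := by
  intro H
  have hyp : ∀ a : Associates (ULift.{x} ℕ), IsPrimary a →
      Precsim (associatesMap (powMonoidHom 2 : ULift.{x} ℕ →* ULift.{x} ℕ) a) a := by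
    intro a _
    obtain ⟨y, rfl⟩ := Associates.mk_surjective a
    exact ⟨2, two_pos, by
      simpa only [associatesMap_mk, powMonoidHom_apply, Associates.mk_pow] using dvd_refl (Associates.mk y ^ 2)⟩
  have key := H (ULift.{x} ℕ) (powMonoidHom 2) hyp (Associates.mk (ULift.up 2))
  rw [associatesMap_mk, powMonoidHom_apply, Associates.mk_eq_mk_iff_associated] at key
  have k2 : Associated ((2 : ℕ) ^ 2) 2 := key.map (MulEquiv.ulift (α := ℕ)).toMonoidHom
  rw [associated_iff_eq] at k2
  norm_num at k2

/-! ### The paper's own non-example: Example 3.7 -/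

/-- **Example 3.7 in the `PreFrobenioidData` rendering of Def. 1.1 (i)**: the pull-back `Φ(f)` of the
monoid of [FrdI] Ex. 3.7 along an arrow `f` of Frobenius degree `2` (found's `Ex37.act ⟨1, 2⟩ :
(g, a) ↦ (g, 2a)` on `G × ℤ_{≥0}`) is not non-dilating — transported from found's
`Ex37.notNonDilating_holds` through the bridge `PreFrobenioidData.isNonDilating_iff_isNonDilating`.
[cite: MochizukiFrdI2008, Ex. 3.7 p.70] -/
theorem not_isNonDilatingOn_ex37 :
    ¬ ∀ (X : Ex36.D) (f : X ⟶ X), IsNonDilating (_root_.Literature.AlgebraicGeometry.Frobenioids.pull Ex37.Φ f) :=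
  fun H => Ex37.notNonDilating_holds fun X f => (isNonDilating_iff_isNonDilating _).mp (H X f)

end PreFrobenioidData

end Literature.AlgebraicGeometry.Frobenioids
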